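import Literature.AlgebraicGeometry.Deformation.MorphismLiftsSquareZeroAffine
import Mathlib.AlgebraicGeometry.Morphisms.Smooth
import Mathlib.RingTheory.Kaehler.Basic
import Mathlib.RingTheory.Smooth.StandardSmoothCotangent
import Mathlib.RingTheory.LocalRing.ResidueField.Basic
import Mathlib.LinearAlgebra.Dimension.Free
import Mathlib.LinearAlgebra.Isomorphisms
import HarnessLib

/-!
# The torsor of lifts across a principal small extension is a `κ`-vector space of dimension the relative dimension
# (SGA 1 III Prop. 5.1 ∕ Mumford §13 p. 126: `Der_{R₀}(Γ(X, V), J) ≅ κ^g` for `J = (t₀) ≅ κ` and `X → Spec R₀` smooth of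
# relative dimension `g` on the chart `V`)

Layer `Literature/AlgebraicGeometry/Deformation`, namespace `Literature.AlgebraicGeometry.Deformation`.  THEOREMS ONLY (no
definition, no named fact, no instance).  Third panel of ★ `Deformation/MorphismLiftsSquareZeroAffine` ([SGA1] Exp. III Prop. 5.1
read on an affine open: the lifts `Spec B → X` through an affine open `V`, over `p : X → Spec R₀`, of a fixed `Spec B₀ → X`
differ by a unique element of `Der_{R₀}(Γ(X, V), ker π)` — `existsUnique_derivation_of_lifts` ∕ `exists_lift_of_derivation`) and
★ `Deformation/MorphismLiftsSquareZeroSmoothAffine` (existence).  [MumfordAV1970] §13, proof of the Theorem p. 126: «the set of all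
liftings is a principal homogeneous space over `Der(𝒪, I) ≅ T ⊗ I`» — a `κ`-VECTOR SPACE OF DIMENSION `g = dim X̂` when `I ≅ κ` is
the kernel of a principal small extension.  This file is that DIMENSION COUNT, in the exact currency of the ★ torsor theorems
(their two `letI` algebra structures `s_V : R₀ → Γ(X, V)` and `ψ₁ : Γ(X, V) → C′`):

* §1 `exists_addEquiv_residueField_of_span_singleton` — for `C′` LOCAL, `t₀ ≠ 0` with `t₀ · 𝔪 = 0`, and `J = (t₀)`:
  `∃ η : J ≃+ κ` (`κ = IsLocalRing.ResidueField C′`) with `η (c • j) = c̄ · η j`, `η (c t₀) = c̄` (the socle line);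
* §2 **`exists_addEquiv_derivation_pi_residueField`** (ring level) — for `S` STANDARD SMOOTH OF RELATIVE DIMENSION `g` over `R₀`
  (Mathlib `Algebra.IsStandardSmoothOfRelativeDimension`), `C′` a local `S`-algebra over `R₀`, `t₀`, `J` as in §1:
  `∃ e : Derivation R₀ S J ≃+ (Fin g → κ), ∀ c δ₁ δ₂, (∀ a, δ₂ a = c · δ₁ a) → e δ₂ = c̄ • e δ₁`
  («additive equivalence + sectionwise scalar clause», instance-free on the derivation side).  Road:
  `Der_{R₀}(S, J) = Hom_S(Ω_{S⁄R₀}, J)` (Mathlib `KaehlerDifferential.linearMapEquivDerivation`), `Ω_{S⁄R₀}` FREE OF RANK `g`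
  (Mathlib `IsStandardSmooth.free_kaehlerDifferential`, `IsStandardSmoothOfRelativeDimension.rank_kaehlerDifferential`,
  `Module.finBasisOfFinrankEq`, `Basis.constr`), §1, and `KaehlerDifferential.span_range_derivation` for the scalar clause;
  `exists_derivation_mul` — the converse half of the clause: `a ↦ c · δ a` IS a derivation, so every `c̄ • e δ` is `e` of one
  (the consumer may take the honest `κ`-space `Fin g → κ` as the parameter space of infinitesimal points, `pt := lift ∘ e.symm`);
* §3 **`exists_addEquiv_derivation_sections_pi_residueField`** (scheme level) — the same for `S := Γ(X, V)` with ★'s `letI`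
  structures, `g₁ : Spec C′ → X` an `R₀`-lift landing in `V`, under the hypothesis **`hVg`**: `s_V` is standard smooth of
  relative dimension `g` (`IsScalarTower R₀ Γ(X, V) C′` is READ OFF `w₁` via ★ `comp_eq_specMap_algebraMap_iff`);
* §4 charts: `exists_isStandardSmoothOfRelativeDimension_chart_of_appLE` (shrink a Mathlib chart `(U, V)` to one with `U = ⊤`:
  Mathlib `exists_basicOpen_le_appLE_of_appLE_of_isAffine` + «standard smooth of relative dimension `n` is stable under
  composition with localisations and isomorphisms»), **`exists_isStandardSmoothOfRelativeDimension_chart`** (`hVg`-charts exist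
  through every point when `[SmoothOfRelativeDimension g p]`) and `…_chart_of_smooth` (`∃ n`, when only `[Smooth p]`).
  A lift from a LOCAL `Spec C′` lands in EVERY open through the image of its closed point (Mathlib
  `Scheme.preimage_eq_top_of_closedPoint_mem`), so the consumer picks the chart first and runs the ★ torsor on it.

Mathlib searched and used: `KaehlerDifferential.linearMapEquivDerivation`, `Derivation.liftKaehlerDifferential_comp_D`,
`KaehlerDifferential.span_range_derivation`, `Algebra.IsStandardSmooth.free_kaehlerDifferential`,
`Algebra.IsStandardSmoothOfRelativeDimension.rank_kaehlerDifferential` ∕ `.isStandardSmooth`, `Module.finBasisOfFinrankEq`,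
`Module.Basis.constr(_symm_apply)`, `LinearMap.toSpanSingleton`, `Submodule.liftQ`, `LinearEquiv.ofBijective`,
`IsLocalRing.ResidueField(.algebraMap_eq)`, `SmoothOfRelativeDimension.exists_isStandardSmoothOfRelativeDimension`,
`Smooth.iff_forall_exists_isStandardSmooth`, `exists_basicOpen_le_appLE_of_appLE_of_isAffine`, `Scheme.Hom.map_appLE`,
`RingHom.isStandardSmoothOfRelativeDimension_{stableUnderCompositionWithLocalizationAway, localizationPreserves, respectsIso}`,
`isLocalization_away_of_isAffine`; Mathlib has no statement about `Der` into a residue-field line.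

Cell hodgecm-mathlib (D-0151), F-3 (Mc) N3′ job J6 «dimension of the lift torsor» = the SOURCE dimension of the Kodaira–Spencer
count in letter S-e of the Artinian tower under `stub_McN3` (`Cruxes/HDel/Lines/F3DualAbelianSchemeMc.lean`; for an abelian
scheme `g = (A.fibre s).toAbelianVariety.dim` is ★ `AbelianSchemes/AbelianSchemeOverFibreDim.dim_fibre_of_isOfRelDim`);
count-neutral generic capital.  HC_CM is proved only modulo the 7 printed citations until rung 0 closes; this file discharges
none of them.

## References
* [SGA1] A. Grothendieck, M. Raynaud, *Revêtements étales et groupe fondamental (SGA 1)*, LNM 224 (1971) ∕ arXiv:math/0206203: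
  Exp. III §5 Prop. 5.1 (the torsor under `𝓗om(g₀^*Ω¹_{X/S}, 𝒥)`), Exp. II §1 (smooth ⇒ `Ω¹` locally free of rank the
  relative dimension).
* [MumfordAV1970] D. Mumford, *Abelian Varieties* (1970), §13, proof of the Theorem, p. 126.
* [StacksProject] Tag 00T7 (standard smooth ⇒ `Ω` free of rank `n − c`), Tag 02H6.
-/

universe u

open CategoryTheory CategoryTheory.Limits AlgebraicGeometry IsLocalRing

noncomputable section

namespace Literature.AlgebraicGeometry.Deformation

/-! ## §1 The kernel of a principal small extension is a line over the residue field -/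

/-- **`J = (t₀)` with `t₀ ≠ 0`, `t₀ · 𝔪 = 0` is a LINE over `κ = C′⁄𝔪`**: there is an additive isomorphism
`η : J ≃+ κ` with `η (c • j) = c̄ · η j` and `η (c t₀) = c̄` (the socle line of an Artinian Gorenstein-type step;
[MumfordAV1970] §13 p. 126 «`I ≅ k`»). [cite: MumfordAV1970, §13 (proof of the Thm. p. 126)] -/
theorem exists_addEquiv_residueField_of_span_singleton {C' : Type u} [CommRing C'] [IsLocalRing C']
    (t₀ : C') (ht₀ : t₀ ≠ 0) (htm : ∀ m ∈ maximalIdeal C', t₀ * m = 0)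
    {J : Ideal C'} (hJ : J = Ideal.span {t₀}) :
    ∃ η : J ≃+ ResidueField C', (∀ (c : C') (j : J), η (c • j) = residue C' c * η j) ∧
      ∀ (c : C') (h : c * t₀ ∈ J), η ⟨c * t₀, h⟩ = residue C' c := by
  classical
  have ht₀J : t₀ ∈ J := hJ ▸ Ideal.mem_span_singleton_self t₀
  -- the surjection `c ↦ c t₀`
  let f : C' →ₗ[C'] J := LinearMap.toSpanSingleton C' J ⟨t₀, ht₀J⟩
  have hf : ∀ c : C', ((f c : J) : C') = c * t₀ := fun c => rfl
  have hker : (maximalIdeal C' : Submodule C' C') ≤ LinearMap.ker f := by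
    intro m hm
    rw [LinearMap.mem_ker]
    apply Subtype.ext
    rw [hf, mul_comm]
    exact htm m hm
  -- it descends to the residue field (`ResidueField C' = C' ⧸ 𝔪` by definition)
  let fbar : ResidueField C' →ₗ[C'] J := (maximalIdeal C').liftQ f hker
  have hfbar : ∀ c : C', fbar (residue C' c) = f c := fun c => Submodule.liftQ_apply _ _ _
  have hinj : Function.Injective fbar := by
    rw [injective_iff_map_eq_zero]
    intro x hx
    obtain ⟨c, rfl⟩ := Ideal.Quotient.mk_surjective x
    change fbar (residue C' c) = 0 at hx
    rw [hfbar] at hx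
    have hc0 : c * t₀ = 0 := by rw [← hf c, hx]; rfl
    have hcm : c ∈ maximalIdeal C' := by
      by_contra hc
      have hu : IsUnit c := by simpa [mem_maximalIdeal, mem_nonunits_iff] using hc
      exact ht₀ ((hu.mul_right_eq_zero).mp hc0)
    exact Ideal.Quotient.eq_zero_iff_mem.mpr hcm
  have hsurj : Function.Surjective fbar := by
    intro j
    obtain ⟨a, ha⟩ := Ideal.mem_span_singleton'.mp (hJ ▸ j.2 : (j : C') ∈ Ideal.span {t₀})
    refine ⟨residue C' a, ?_⟩
    rw [hfbar]
    exact Subtype.ext (by rw [hf, ha])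
  let e : ResidueField C' ≃ₗ[C'] J := LinearEquiv.ofBijective fbar ⟨hinj, hsurj⟩
  have he : ∀ c : C', e (residue C' c) = f c := hfbar
  refine ⟨e.symm.toAddEquiv, fun c j => ?_, fun c h => ?_⟩
  · -- `η (c • j) = c • η j = c̄ * η j`
    change e.symm (c • j) = residue C' c * e.symm j
    rw [LinearEquiv.map_smul, Algebra.smul_def, ResidueField.algebraMap_eq]
  · change e.symm ⟨c * t₀, h⟩ = residue C' c
    rw [LinearEquiv.symm_apply_eq]
    exact (Subtype.ext (by rw [he, hf])).symm

/-! ## §2 Ring level: `Der_{R₀}(S, J) ≃ κ^g` for `S` standard smooth of relative dimension `g` over `R₀` -/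

/-- **DIMENSION OF THE LIFT TORSOR, ring level.**  Let `S` be a STANDARD SMOOTH `R₀`-algebra of relative
dimension `g`, `C′` a LOCAL `S`-algebra (compatibly an `R₀`-algebra), `t₀ ∈ C′` with `t₀ ≠ 0`, `t₀ · 𝔪 = 0`, and
`J = (t₀)` (a `C′`-ideal, an `S`-module through `S → C′`).  Then the `R₀`-derivations of `S` into `J` — the group
under which the lifts across the principal small extension `C′ ↠ C′⁄J` form a torsor ([SGA1] III 5.1, ★
`MorphismLiftsSquareZeroAffine`) — are a `κ`-vector space of dimension `g`, `κ = C′⁄𝔪`: an additive isomorphism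
`e : Der_{R₀}(S, J) ≃+ κ^g` under which «multiplying a derivation by `c ∈ C′`» becomes multiplication by `c̄`.
Road: `Der_{R₀}(S, J) = Hom_S(Ω_{S∕R₀}, J)` (Mathlib `KaehlerDifferential.linearMapEquivDerivation`), `Ω_{S∕R₀}` free of
rank `g` (Mathlib `IsStandardSmooth.free_kaehlerDifferential`, `IsStandardSmoothOfRelativeDimension.rank_kaehlerDifferential`),
and `J ≅ κ` (`exists_addEquiv_residueField_of_span_singleton`).
[cite: SGA1, Exp. III §5 Prop. 5.1] [cite: MumfordAV1970, §13 (proof of the Thm. p. 126)] [cite: StacksProject, Tag 00T7] -/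
theorem exists_addEquiv_derivation_pi_residueField {R₀ S C' : Type u} [CommRing R₀] [CommRing S] [Algebra R₀ S]
    (g : ℕ) [Algebra.IsStandardSmoothOfRelativeDimension g R₀ S]
    [CommRing C'] [IsLocalRing C'] [Algebra R₀ C'] [Algebra S C'] [IsScalarTower R₀ S C']
    (t₀ : C') (ht₀ : t₀ ≠ 0) (htm : ∀ m ∈ maximalIdeal C', t₀ * m = 0)
    {J : Ideal C'} (hJ : J = Ideal.span {t₀}) :
    ∃ e : Derivation R₀ S J ≃+ (Fin g → ResidueField C'),
      ∀ (c : C') (δ₁ δ₂ : Derivation R₀ S J), (∀ a, (δ₂ a : C') = c * δ₁ a) →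
        e δ₂ = residue C' c • e δ₁ := by
  classical
  haveI : Nontrivial S := (algebraMap S C').domain_nontrivial
  haveI : Algebra.IsStandardSmooth R₀ S := Algebra.IsStandardSmoothOfRelativeDimension.isStandardSmooth g
  -- `Ω_{S/R₀}` is free of rank `g`
  have hrank : Module.finrank S (Ω[S⁄R₀]) = g :=
    Module.finrank_eq_of_rank_eq (Algebra.IsStandardSmoothOfRelativeDimension.rank_kaehlerDifferential g)
  let b : Module.Basis (Fin g) S (Ω[S⁄R₀]) := Module.finBasisOfFinrankEq S _ hrank
  -- `J ≅ κ`
  obtain ⟨η, hη, -⟩ := exists_addEquiv_residueField_of_span_singleton t₀ ht₀ htm hJ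
  -- `Der = Hom(Ω, J) = J^g`
  let e₁ : Derivation R₀ S J ≃ₗ[S] (Ω[S⁄R₀] →ₗ[S] J) := (KaehlerDifferential.linearMapEquivDerivation R₀ S).symm
  have he₁ : ∀ (δ : Derivation R₀ S J) (a : S), e₁ δ (KaehlerDifferential.D R₀ S a) = δ a :=
    fun δ a => Derivation.liftKaehlerDifferential_comp_D δ a
  let e₂ : (Ω[S⁄R₀] →ₗ[S] J) ≃ₗ[S] (Fin g → J) := (b.constr S).symm
  have he₂ : ∀ (L : Ω[S⁄R₀] →ₗ[S] J) (i : Fin g), e₂ L i = L (b i) := fun L i => Module.Basis.constr_symm_apply _ _ _ _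
  let e : Derivation R₀ S J ≃+ (Fin g → ResidueField C') :=
    ((e₁.trans e₂).toAddEquiv).trans (AddEquiv.piCongrRight fun _ => η)
  have he : ∀ (δ : Derivation R₀ S J) (i : Fin g), e δ i = η (e₁ δ (b i)) := fun δ i => by
    change η (e₂ (e₁ δ) i) = _
    rw [he₂]
  refine ⟨e, fun c δ₁ δ₂ h => ?_⟩
  -- the pointwise relation `δ₂ = c · δ₁` extends to `Ω` (`Ω` is spanned by `dS`)
  have key : ∀ ω : Ω[S⁄R₀], ((e₁ δ₂ ω : J) : C') = c * ((e₁ δ₁ ω : J) : C') := by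
    intro ω
    have hω : ω ∈ Submodule.span S (Set.range (KaehlerDifferential.D R₀ S)) := by
      rw [KaehlerDifferential.span_range_derivation]; trivial
    induction hω using Submodule.span_induction with
    | mem x hx =>
      obtain ⟨a, rfl⟩ := hx
      rw [he₁, he₁]
      exact h a
    | zero => simp
    | add x y _ _ hx hy => rw [map_add, map_add, Submodule.coe_add, Submodule.coe_add, hx, hy, mul_add]
    | smul s x _ hx =>
      rw [map_smul, map_smul, Submodule.coe_smul_of_tower, Submodule.coe_smul_of_tower, hx, Algebra.smul_def,
        Algebra.smul_def, mul_left_comm]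
  funext i
  rw [Pi.smul_apply, smul_eq_mul, he, he]
  have hi : e₁ δ₂ (b i) = c • e₁ δ₁ (b i) := Subtype.ext (by rw [key]; rfl)
  rw [hi, hη]

/-- **The `C′`-scalars act on `Der_{R₀}(S, J)` sectionwise** (the other half of the «sectionwise scalar clause»: for every
derivation `δ` and `c ∈ C′` the pointwise multiple `a ↦ c · δ a` IS an `R₀`-derivation), so that under the equivalence of
`exists_addEquiv_derivation_pi_residueField` EVERY `κ`-multiple `c̄ • e δ` is `e` of a derivation.  Stated instance-free (no
`Module C′ (Derivation …)` is used by the consumer). [cite: SGA1, Exp. III §5 Prop. 5.1] -/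
theorem exists_derivation_mul {R₀ S C' : Type u} [CommRing R₀] [CommRing S] [Algebra R₀ S]
    [CommRing C'] [Algebra R₀ C'] [Algebra S C'] [IsScalarTower R₀ S C'] (J : Ideal C') (c : C')
    (δ : Derivation R₀ S J) : ∃ δ' : Derivation R₀ S J, ∀ a, (δ' a : C') = c * δ a := by
  refine ⟨{ toFun := fun a => c • δ a,
             map_add' := fun a b => by rw [map_add, smul_add],
             map_smul' := fun r a => ?_,
             map_one_eq_zero' := by
               change c • δ 1 = 0
               rw [δ.map_one_eq_zero, smul_zero],
             leibniz' := fun a b => ?_ }, fun a => rfl⟩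
  · -- `c • δ (r • a) = r • (c • δ a)`
    apply Subtype.ext
    change c * (δ (r • a) : C') = ((r • (c • δ a) : J) : C')
    rw [δ.map_smul]
    simp only [Submodule.coe_smul_of_tower, smul_eq_mul, Algebra.smul_def]
    ring
  · -- Leibniz: `c • δ (a b) = a • (c • δ b) + b • (c • δ a)`
    apply Subtype.ext
    change c * (δ (a * b) : C') = ((a • (c • δ b) + b • (c • δ a) : J) : C')
    rw [δ.leibniz]
    simp only [Submodule.coe_add, Submodule.coe_smul_of_tower, smul_eq_mul, Algebra.smul_def]
    ring

/-! ## §3 Scheme level: the currency of ★ `MorphismLiftsSquareZeroAffine` -/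

/-- **DIMENSION OF THE LIFT TORSOR, scheme level** ([SGA1] Exp. III Prop. 5.1: the lifts through `V` form a torsor
under `Der_{R₀}(Γ(X, V), 𝒥)`; [MumfordAV1970] §13 p. 126: «the set of all liftings is a principal homogeneous space
over `Der … ≅ T ⊗ I`, a vector space of dimension `g`»).  Data, in the currency of ★ `existsUnique_derivation_of_lifts`
∕ `exists_lift_of_derivation`: `p : X → Spec R₀`, an affine open `V ⊆ X` on which `p` is a STANDARD-SMOOTH CHART OF
RELATIVE DIMENSION `g` (`hVg`, for the scalar map `s_V = ΓSpecIso⁻¹ ≫ p.appLE ⊤ V`; such `V` exist through every point when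
`p` is smooth of relative dimension `g`, `exists_isStandardSmoothOfRelativeDimension_chart`), a lift `g₁ : Spec C′ → X`
over `R₀` landing in `V` (chart `ψ₁ = g₁.appLE V ⊤ ≫ ΓSpecIso C′`, through which `J` is a `Γ(X, V)`-module), `C′` LOCAL,
`t₀ ∈ C′` with `t₀ ≠ 0`, `t₀ · 𝔪 = 0`, and an ideal `J = (t₀)` (e.g. `J := ker q` of a principal small extension
`q : C′ ↠ C`).  Conclusion: `Der_{R₀}(Γ(X, V), J) ≃+ κ^g`, `κ = C′⁄𝔪`, compatibly with the `C′`-scalars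
(«multiplying a derivation by `c`» ↦ multiplication by `c̄`).
[cite: SGA1, Exp. III §5 Prop. 5.1] [cite: MumfordAV1970, §13 (proof of the Thm. p. 126)] -/
theorem exists_addEquiv_derivation_sections_pi_residueField {X : Scheme.{u}} {V : X.Opens} (hV : IsAffineOpen V)
    {R₀ C' : Type u} [CommRing R₀] [CommRing C'] [IsLocalRing C'] [Algebra R₀ C']
    (p : X ⟶ Spec (.of R₀)) (g : ℕ)
    (hVg : ((Scheme.ΓSpecIso (.of R₀)).inv ≫ p.appLE ⊤ V le_top).hom.IsStandardSmoothOfRelativeDimension g)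
    (g₁ : Spec (.of C') ⟶ X) (w₁ : g₁ ≫ p = Spec.map (CommRingCat.ofHom (algebraMap R₀ C')))
    (hg₁ : g₁ ⁻¹ᵁ V = ⊤)
    (t₀ : C') (ht₀ : t₀ ≠ 0) (htm : ∀ m ∈ maximalIdeal C', t₀ * m = 0)
    {J : Ideal C'} (hJ : J = Ideal.span {t₀}) :
    letI : Algebra R₀ Γ(X, V) := ((Scheme.ΓSpecIso (.of R₀)).inv ≫ p.appLE ⊤ V le_top).hom.toAlgebra
    letI : Algebra Γ(X, V) C' := (g₁.appLE V ⊤ hg₁.ge ≫ (Scheme.ΓSpecIso (.of C')).hom).hom.toAlgebra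
    ∃ e : Derivation R₀ Γ(X, V) J ≃+ (Fin g → ResidueField C'),
      ∀ (c : C') (δ₁ δ₂ : Derivation R₀ Γ(X, V) J), (∀ a, (δ₂ a : C') = c * δ₁ a) →
        e δ₂ = residue C' c • e δ₁ := by
  set s : CommRingCat.of R₀ ⟶ Γ(X, V) := (Scheme.ΓSpecIso (.of R₀)).inv ≫ p.appLE ⊤ V le_top with hs
  set ψ₁ : Γ(X, V) ⟶ CommRingCat.of C' := g₁.appLE V ⊤ hg₁.ge ≫ (Scheme.ΓSpecIso (.of C')).hom with hψ₁
  letI : Algebra R₀ Γ(X, V) := s.hom.toAlgebra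
  letI : Algebra Γ(X, V) C' := ψ₁.hom.toAlgebra
  -- `g₁` is an `R₀`-morphism: its chart is an `R₀`-algebra map, i.e. the scalar tower `R₀ → Γ(X, V) → C'` commutes
  have e₁ : g₁ = Spec.map ψ₁ ≫ hV.fromSpec := eq_specMap_appLE_comp_fromSpec hV g₁ hg₁
  have c₁ : s ≫ ψ₁ = CommRingCat.ofHom (algebraMap R₀ C') :=
    (comp_eq_specMap_algebraMap_iff hV p ψ₁).mp (e₁ ▸ w₁)
  haveI : IsScalarTower R₀ Γ(X, V) C' := IsScalarTower.of_algebraMap_eq fun r =>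
    (congrArg (fun f : CommRingCat.of R₀ ⟶ CommRingCat.of C' => f.hom r) c₁).symm
  haveI : Algebra.IsStandardSmoothOfRelativeDimension g R₀ Γ(X, V) := hVg
  exact exists_addEquiv_derivation_pi_residueField g t₀ ht₀ htm hJ

/-! ## §4 Standard-smooth charts of relative dimension `g` exist through every point -/

/-- **Chart shrinking.**  If `p : X → Spec R₀` is standard smooth of relative dimension `n` on some affine chart
`(U ⊆ Spec R₀, V ⊆ X)` through `x`, then through `x` there is an affine open `V′` whose FULL scalar map
`s_{V′} = ΓSpecIso⁻¹ ≫ p.appLE ⊤ V′ : R₀ → Γ(X, V′)` is standard smooth of relative dimension `n` (shrink to basic opens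
with `U` replaced by `⊤`, Mathlib `exists_basicOpen_le_appLE_of_appLE_of_isAffine`, then absorb the localisation
`R₀ → R₀[1∕r]`, standard smooth of relative dimension `0`). [cite: StacksProject, Tag 00T7] -/
theorem exists_isStandardSmoothOfRelativeDimension_chart_of_appLE {X : Scheme.{u}} {R₀ : Type u} [CommRing R₀]
    (p : X ⟶ Spec (.of R₀)) (n : ℕ) (x : X) {U : (Spec (.of R₀)).Opens} (hU : IsAffineOpen U) {V : X.Opens}
    (hV : IsAffineOpen V) (hxV : x ∈ V) (e : V ≤ p ⁻¹ᵁ U)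
    (hP : (p.appLE U V e).hom.IsStandardSmoothOfRelativeDimension n) :
    ∃ V' : X.Opens, IsAffineOpen V' ∧ x ∈ V' ∧
      ((Scheme.ΓSpecIso (.of R₀)).inv ≫ p.appLE ⊤ V' le_top).hom.IsStandardSmoothOfRelativeDimension n := by
  obtain ⟨r, t, hxt, e', hP'⟩ := exists_basicOpen_le_appLE_of_appLE_of_isAffine
    (P := fun f => f.IsStandardSmoothOfRelativeDimension n)
    (RingHom.isStandardSmoothOfRelativeDimension_stableUnderCompositionWithLocalizationAway n).2
    (RingHom.isStandardSmoothOfRelativeDimension_localizationPreserves n).away x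
    ⟨⊤, isAffineOpen_top _⟩ ⟨U, hU⟩ ⟨V, hV⟩ ⟨V, hV⟩ hxV hxV e hP (TopologicalSpace.Opens.mem_top _)
  refine ⟨X.basicOpen t, hV.basicOpen t, hxt, ?_⟩
  -- `s_{D(t)} = ΓSpecIso⁻¹ ≫ (R₀ → R₀[1/r]) ≫ p.appLE D(r) D(t)`
  have hfac : (Scheme.ΓSpecIso (.of R₀)).inv ≫ p.appLE ⊤ (X.basicOpen t) le_top =
      (Scheme.ΓSpecIso (.of R₀)).inv ≫ ((Spec (.of R₀)).presheaf.map (homOfLE ((Spec (.of R₀)).basicOpen_le r)).op ≫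
        p.appLE ((Spec (.of R₀)).basicOpen r) (X.basicOpen t) e') := by
    rw [Scheme.Hom.map_appLE]
  have h1 : ((p.appLE ((Spec (.of R₀)).basicOpen r) (X.basicOpen t) e').hom.comp
      (algebraMap Γ(Spec (.of R₀), ⊤) Γ(Spec (.of R₀), (Spec (.of R₀)).basicOpen r))).IsStandardSmoothOfRelativeDimension n :=
    (RingHom.isStandardSmoothOfRelativeDimension_stableUnderCompositionWithLocalizationAway n).1
      Γ(Spec (.of R₀), (Spec (.of R₀)).basicOpen r) r _ hP'
  have h2 := (RingHom.isStandardSmoothOfRelativeDimension_respectsIso (n := n)).2 _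
    (Scheme.ΓSpecIso (.of R₀)).symm.commRingCatIsoToRingEquiv h1
  rw [hfac]
  exact h2

/-- **Charts, from `SmoothOfRelativeDimension g`.**  If `p : X → Spec R₀` is smooth of relative dimension `g` (Mathlib:
locally standard smooth of relative dimension `g` on affine charts), then through every point `x ∈ X` there is an AFFINE
OPEN `V` whose full scalar map `s_V = ΓSpecIso⁻¹ ≫ p.appLE ⊤ V : R₀ → Γ(X, V)` is standard smooth of relative dimension `g`.
For a LOCAL test scheme every lift through `x` lands in such a `V` (Mathlib `Scheme.preimage_eq_top_of_closedPoint_mem`),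
so the torsor theorems ★ `existsUnique_derivation_of_lifts` ∕ `exists_lift_of_derivation` run on it.
[cite: StacksProject, Tag 00T7] [cite: SGA1, Exp. III §5 Prop. 5.1] -/
theorem exists_isStandardSmoothOfRelativeDimension_chart {X : Scheme.{u}} {R₀ : Type u} [CommRing R₀]
    (p : X ⟶ Spec (.of R₀)) (g : ℕ) [SmoothOfRelativeDimension g p] (x : X) :
    ∃ V : X.Opens, IsAffineOpen V ∧ x ∈ V ∧
      ((Scheme.ΓSpecIso (.of R₀)).inv ≫ p.appLE ⊤ V le_top).hom.IsStandardSmoothOfRelativeDimension g := by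
  obtain ⟨U, hU, V, hV, hxV, e, hP⟩ :=
    SmoothOfRelativeDimension.exists_isStandardSmoothOfRelativeDimension (n := g) (f := p) x
  exact exists_isStandardSmoothOfRelativeDimension_chart_of_appLE p g x hU hV hxV e hP

/-- **Charts, from `Smooth`** (no global relative dimension, e.g. over a disconnected base): if `p : X → Spec R₀` is
smooth, then through every point `x ∈ X` there is an affine open `V` whose full scalar map `s_V` is standard smooth of
SOME relative dimension `n` (the dimension of a submersive presentation of Mathlib's chart). [cite: StacksProject, Tag 00T7] -/
theorem exists_isStandardSmoothOfRelativeDimension_chart_of_smooth {X : Scheme.{u}} {R₀ : Type u} [CommRing R₀]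
    (p : X ⟶ Spec (.of R₀)) [Smooth p] (x : X) :
    ∃ (n : ℕ) (V : X.Opens), IsAffineOpen V ∧ x ∈ V ∧
      ((Scheme.ΓSpecIso (.of R₀)).inv ≫ p.appLE ⊤ V le_top).hom.IsStandardSmoothOfRelativeDimension n := by
  obtain ⟨U, hU, V, hV, hxV, e, hf⟩ := (Smooth.iff_forall_exists_isStandardSmooth (f := p)).mp ‹_› x
  obtain ⟨n, hn⟩ : ∃ n, (p.appLE U V e).hom.IsStandardSmoothOfRelativeDimension n := by
    letI := (p.appLE U V e).hom.toAlgebra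
    have hf' : Algebra.IsStandardSmooth Γ(Spec (.of R₀), U) Γ(X, V) := hf
    obtain ⟨ι, σ, _, _, ⟨P⟩⟩ := hf'.out
    exact ⟨P.dimension, P.isStandardSmoothOfRelativeDimension rfl⟩
  exact ⟨n, exists_isStandardSmoothOfRelativeDimension_chart_of_appLE p n x hU hV hxV e hn⟩

end Literature.AlgebraicGeometry.Deformation

end
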